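import Summits.BirchSwinnertonDyer.BirchSwinnertonDyer.Theorems.GenusKolyvaginAtTwoPowDvdShaCardAtTwoPosT
import HarnessLib

/-!
# Route `GenusKolyvaginAtTwo`, residual item `OffCutResidualAtTwoR` (stmt-BirchSwinnertonDyer-31767), LINE 24 «strict_def2», stub X⁼²
# `stub_kolyvaginExactAtTwoPosDiscDefectTwo`: ITS LOWER HALF IS DEFECT-FREE — `2^(2M₀) ∣ #Ш(E/K)[2^∞]` on the Δ>0 cut for a 2-Selmer-minimal
# twin of ANY Tamagawa defect

Seat `bsd-line-gk2-p3` g32 (PROVER seat 3/3, cell `bsd-f1-sign2`), `--supports stmt-BirchSwinnertonDyer-31767` (helper; closes nothing).  THEOREMS ONLY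
(no definition, no named fact, no `sorry`); standard axioms.  **BSD is NOT proved by this file; X⁼² / LINE 24 / 31767 are NOT proved; no item is
closed.**  CONDITIONAL on the antecedent Q2 `KolyvaginRelationAtTwo` (route item 24880), displayed — exactly as the landed L⁺_T′.

THE POINT.  LINE 24's stub X⁼² is Q4_T′ `KolyvaginExactAtTwoPosDiscT` VERBATIM with the twin's Tamagawa defect `padicValNat 2 Wd.tamagawaProduct = 2`
in place of `= 0` (a 2-Selmer-minimal Heegner twin of defect 2 — one identity prime or two transposition primes — for the STRICT residual cells).
Its LOWER half is the landed L⁺_T′ `powDvdShaCardAtTwoPosT_proof` (gk2-p2 g22, road (E4)⁺) read again: that proof NEVER uses the defect hypothesis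
(`_hTam` there).  This file records the defect-free statement once, so that only the UPPER half (the defect-2 budget B⁼² of the card's price P1)
remains of X⁼²:

* `powDvdShaCard_posCut_anyTwinDefect` — L⁺_T′'s statement with the binder `padicValNat 2 Wd.tamagawaProduct = 0 →` DELETED: on the Δ>0 cut
  (Q2; non-CM, odd `C(E)`, an odd multiplicative place, `Δ_E > 0`, `K` odd-`d_K ≠ −3` Heegner with the Theorem-B₂ non-squares, `ρ_{E,2^∞}` onto,
  `y_K` of infinite order with exponent `M₀`, `w(E) = 1`, a globally minimal twin with `#Sel₂(Wd) = 2` of ANY Tamagawa defect, a transposition-deep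
  Kolyvagin witness): **`2^(2M₀) ∣ #Ш(E/K)[2^∞]`**.  Same cone as `powDvdShaCardAtTwoPosT_proof` (sockets of gk2-p2/p4/p5, `rank E(K) ≤ 1` from
  B2Q⁺), verbatim.  X⁼²'s lower half is the instance at defect `2` (the defect binder is simply not consumed).

References: [McCallumLMS1991] §5 Prop. 5.2, Thm. 5.4; [Kolyvagin1991StructureSha]; [Kolyvagin1991MathAnn] Thm. 2.1–2.2; [GrossLMS1991] §10;
[Kramer1981] Thm. 1.
-/

set_option autoImplicit false
set_option linter.dupNamespace false -- `Summit.<P>.<Sub>` repeats `BirchSwinnertonDyer` (D-0017)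

noncomputable section

open scoped Classical
open scoped AddSubgroup

open Function Field NumberField IsDedekindDomain WeierstrassCurve
open Literature.NumberTheory.EllipticCurves Literature.NumberTheory.GaloisRepresentations
open Literature.NumberTheory.EllipticCurves.ModularForms
open Literature.NumberTheory.GaloisCohomology
open Summit.BirchSwinnertonDyer.Rank1Residual.JET.GlobalDuality
open Summit.BirchSwinnertonDyer.BirchSwinnertonDyer.Theses.GenusKolyvaginAtTwo
open Summit.BirchSwinnertonDyer.Rank1Residual
open Summit.BirchSwinnertonDyer.BirchSwinnertonDyer.Theorems.GenusExact.PlusDescent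

namespace Summit.BirchSwinnertonDyer.BirchSwinnertonDyer.Theorems.GenusExact.StrictDef2

/-- **L⁺_T′ FOR A TWIN OF ANY TAMAGAWA DEFECT: `2^(2M₀) ∣ #Ш(E/K)[2^∞]` on the Δ>0 cut** — the statement of the route item `PowDvdShaCardAtTwoPosT`
(stmt-BirchSwinnertonDyer-25501) with the binder `padicValNat 2 Wd.tamagawaProduct = 0 →` deleted; proof = `powDvdShaCardAtTwoPosT_proof` (road (E4)⁺)
verbatim, which does not use that binder.  CONDITIONAL on Q2 (displayed).  BSD is NOT proved by this.
[cite: McCallumLMS1991, §5 Prop. 5.2, Thm. 5.4 (p. 310)] [cite: Kolyvagin1991StructureSha] [cite: Kolyvagin1991MathAnn, Thm. 2.1–2.2] [cite: GrossLMS1991, §10] -/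
theorem powDvdShaCard_posCut_anyTwinDefect (hQ2 : KolyvaginRelationAtTwo)
    (W : WeierstrassCurve ℚ) [W.IsElliptic] [W.IsGloballyMinimal] [NeZero (W.conductorNorm ℤ)] (hcm : ¬ W.HasCM) (hT : Odd W.tamagawaProduct)
    (v : IsDedekindDomain.HeightOneSpectrum (NumberField.RingOfIntegers ℚ)) (h2v : ((2 : ℕ) : NumberField.RingOfIntegers ℚ) ∉ v.asIdeal)
    (hNv : ((W.conductorNorm ℤ : ℕ) : NumberField.RingOfIntegers ℚ) ∈ v.asIdeal) (hmult : W.HasMultiplicativeReductionAt v)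
    (K : Type) [Field K] [NumberField K] (hIQ : IsImaginaryQuadratic K) (hodd : Odd (NumberField.discr K)) (h3 : NumberField.discr K ≠ -3)
    (hHe : SatisfiesHeegnerHypothesis (W.conductorNorm ℤ) K)
    (hsq1 : ¬ IsSquare ((NumberField.discr K : ℚ) * -|W.Δ|)) (hsq2 : ¬ IsSquare ((NumberField.discr K : ℚ) * (-(2 * |W.Δ|))))
    (hρ : ∀ n : ℕ, 0 < n → W.HasSurjectiveModNGaloisRep ((2 : ℤ) ^ n))
    (Dt : ModularParametrizationData W (W.conductorNorm ℤ)) (β : ℤ) (ι : K →+* ℂ) (d₁ : KolyvaginHeegnerData Dt β ι 1)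
    (hy : ¬ IsOfFinAddOrder d₁.derivedPoint) (M₀ : ℕ)
    (hdiv : ∃ Q : (W.baseChange (ringClassField K ι 1)).toAffine.Point, ((2 ^ M₀ : ℕ) : ℤ) • Q = d₁.derivedPoint)
    (hndiv : ¬ ∃ Q : (W.baseChange (ringClassField K ι 1)).toAffine.Point, ((2 ^ (M₀ + 1) : ℕ) : ℤ) • Q = d₁.derivedPoint)
    (hw : W.rootNumber = 1)
    (Wd : WeierstrassCurve ℚ) [Wd.IsElliptic] [Wd.IsGloballyMinimal]
    (hWd : ∃ C : WeierstrassCurve.VariableChange ℚ, C • W.quadraticTwist (NumberField.discr K : ℚ) = Wd) (hSel : Nat.card (Wd.selmerGroup 2) = 2)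
    (n₀ : ℕ) (e₀ : KolyvaginHeegnerData Dt β ι n₀) (hn₀ : Squarefree n₀)
    (hKoly : ∀ ℓ ∈ n₀.primeFactors, Zhang2014.IsKolyvaginPrime (W.conductorNorm ℤ) W K 2 ℓ ∧ 2 ≤ Zhang2014.kolyvaginIndex W 2 ℓ ∧
      ∃ (v : IsDedekindDomain.HeightOneSpectrum (NumberField.RingOfIntegers ℚ)) (𝔓 : Ideal (absIntegers (NumberField.RingOfIntegers ℚ) ℚ))
        (h : Field.absoluteGaloisGroup ℚ), ((ℓ : ℕ) : NumberField.RingOfIntegers ℚ) ∈ v.asIdeal ∧ 𝔓 ∈ v.primesAbove ∧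
        IsArithFrobAt (NumberField.RingOfIntegers ℚ) h 𝔓 ∧ ∃ u : W.geomTorsion ((2 : ℕ) : ℤ), h • u ≠ u)
    (he₀ : ¬ ∃ Q : (W.baseChange (ringClassField K ι n₀)).toAffine.Point, (2 : ℤ) • Q = e₀.derivedPoint) :
    2 ^ (2 * M₀) ∣ Nat.card (AddCommGroup.primaryComponent (W.baseChange K).sha 2) := by
  obtain ⟨τ, hτ, -⟩ := exists_conj_of_isImaginaryQuadratic (K := K) hIQ
  haveI : ∀ j : ℕ, NumberField (ringClassField K ι j) := JET.numberField_ringClassField K hIQ ι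
  have hsurN' : ∀ m : ℕ, W.HasSurjectiveModNGaloisRep (2 ^ m : ℕ) := fun m ↦ by
    exact_mod_cast Summit.BirchSwinnertonDyer.BirchSwinnertonDyer.Theorems.MinimalTwinBSDTwo.forall_hasSurjectiveModNGaloisRep_two_pow_of_pos W hρ m
  -- `rank E(K) ≤ 1` on the cut (gk2-p2 g22, `…PosTRankLeOnePosCut`)
  have hrk : (W.baseChange K).mordellWeilRank ≤ 1 :=
    mordellWeilRank_baseChange_le_one_onPosCut hQ2 W hcm hT v h2v hNv hmult K hIQ hodd h3 hHe hsq1 hsq2 hρ Dt β ι d₁ hy M₀ hndiv hw Wd hWd hSel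
  -- the witness clause in the Theorems' spelling (`geomTorsion W 2`)
  have hKoly' : ∀ ℓ ∈ n₀.primeFactors, Zhang2014.IsKolyvaginPrime (W.conductorNorm ℤ) W K 2 ℓ ∧ 2 ≤ Zhang2014.kolyvaginIndex W 2 ℓ ∧
      ∃ (v : HeightOneSpectrum (𝓞 ℚ)) (𝔓 : Ideal (absIntegers (𝓞 ℚ) ℚ)) (h : absoluteGaloisGroup ℚ),
        (ℓ : 𝓞 ℚ) ∈ v.asIdeal ∧ 𝔓 ∈ v.primesAbove ∧ IsArithFrobAt (𝓞 ℚ) h 𝔓 ∧ ∃ u : geomTorsion W 2, h • u ≠ u := by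
    intro ℓ hℓ
    obtain ⟨hZ, hidx, v', 𝔓, h, hv', h𝔓, hfr, hu⟩ := hKoly ℓ hℓ
    exact ⟨hZ, hidx, v', 𝔓, h, hv', h𝔓, hfr, exists_smul_ne_two_of_natCast W hu⟩
  exact pow_dvd_natCard_sha_of_sockets_of_rank_le_one_transposition hQ2 W hcm hT v h2v hNv hmult K hIQ hodd h3 hHe hsq1 hsq2 hρ Dt β ι d₁ hy
    M₀ hdiv hndiv hrk τ hτ
    (exists_transposition_kolyvaginPrime_localization_fullOrder_pair_deep W K hIQ hodd hHe hsurN' τ hτ (2 * (M₀ + 6)) 1 (by omega))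
    (GenusExact.TransverseValue.hbot_socket_margin_onHabitat_of_three_le_transposition W hQ2 hcm hT hsurN' hIQ hodd h3 hHe hsq1 hsq2 h2v hNv hmult
      Dt β ι (L := 2 * (M₀ + 6)) (by omega) 1 (by omega) _ (fun q _ hidx hF ↦ ⟨hidx, hF⟩) hn₀ hKoly' e₀ he₀)
    (deepSwap_socket_transposition W hcm hT hsurN' hIQ hodd h3 hHe τ hτ Dt β ι hQ2 (M₀ := M₀) (L := 2 * (M₀ + 6)) (k := 1) (by omega) le_rfl
      (Summit.BirchSwinnertonDyer.BirchSwinnertonDyer.Theorems.GenusExact.NonPhantomPow.nonPhantomAtTwo_of_hasMultiplicativeReductionAt W hT hρ hIQ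
        hodd hsq1 hsq2 (NeZero.ne (W.conductorNorm ℤ)) hHe h2v hNv hmult (2 * (M₀ + 6) + 1) (by omega)))
    (fun r ℓ hℓ C hC ↦ hK_socket_margin_of_frob_smul_ne W hIQ hτ (L := 2 * (M₀ + 6)) (by omega) r 1 ℓ hℓ C hC)

end Summit.BirchSwinnertonDyer.BirchSwinnertonDyer.Theorems.GenusExact.StrictDef2

end
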